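import Mathlib
import HarnessLib
import Literature.AlgebraicGeometry.Ramification.InertiaNormalSylow
import Summits.ResolutionOfSingularities.ResolutionOfSingularities.Theorems.WildQuotientsWildQuotientResolutionPointMoveNoNpcCurves

/-!
# Point moves on regular threefolds create no curves of non-p-closed inertia (regular-local-ring form; crux `WildQuotients.WildQuotientResolution`)

Crux stmt-ResolutionOfSingularities-15640 (`WildQuotientResolution`), registered stub
`stub_phaseZeroHighDim`, move-game track (`…PointMove` p810587). The form of
✓`PointMoveNoNpcCurves.hasNormalSylow_inertia_of_pointBlowup_of_not_surjective` with the
hypothesis «`𝔪_z` is generated by three elements» discharged from «`𝒪_{X′,z}` is a regular local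
ring of dimension `3`» (Mathlib `IsRegularLocalRing`: `spanFinrank 𝔪 = dim`) — the situation of
`PointMove.pointMove` on a regular threefold at a closed point `z` of the centre. Memo
`PHASE0-DIM3-TERMINATION.md` §1.

[OURS · crux stmt-ResolutionOfSingularities-15640 · helper toward `stub_phaseZeroHighDim`
(threefold Phase 0); folklore, counted 0; AI-level work, weaker than expert review.]
-/

-- single-problem summit: the doubled namespace component `ResolutionOfSingularities` is forced
set_option linter.dupNamespace false

namespace Summit.ResolutionOfSingularities.ResolutionOfSingularities.Theorems.WildQuotientResolution.PointMoveNoNpcCurves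

open CategoryTheory AlgebraicGeometry TopologicalSpace IsLocalRing
open Literature.AlgebraicGeometry.Resolution Literature.AlgebraicGeometry.Ramification

/-- A regular local ring of dimension `3` has its maximal ideal generated by three elements
(`spanFinrank 𝔪 = dim`, Mathlib's definition of regularity). [folklore] -/
theorem exists_fin_three_span_eq_maximalIdeal (R : Type*) [CommRing R] [IsRegularLocalRing R]
    (hdim3 : ringKrullDim R = (3 : ℕ)) :
    ∃ y : Fin 3 → R, Ideal.span (Set.range y) = maximalIdeal R := by
  classical
  obtain ⟨s, hs, hspan⟩ := Submodule.FG.exists_span_finset_card_eq_spanFinrank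
    (maximalIdeal R).fg_of_isNoetherianRing
  have hcard : s.card = 3 := by
    have h := IsRegularLocalRing.spanFinrank_maximalIdeal (R := R)
    rw [hdim3, ← hs] at h
    exact_mod_cast h
  have e : ↥s ≃ Fin 3 := s.equivFin.trans (finCongr hcard)
  refine ⟨fun i => (e.symm i : R), ?_⟩
  have hrange : Set.range (fun i => (e.symm i : R)) = (s : Set R) := by
    ext a
    constructor
    · rintro ⟨i, rfl⟩
      exact (e.symm i).2
    · intro ha
      exact ⟨e ⟨a, ha⟩, by simp⟩
  rw [hrange]
  exact hspan

/-- **Point moves on a regular threefold create no NPC curves** (regular-local-ring form of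
✓`hasNormalSylow_inertia_of_pointBlowup_of_not_surjective`): for the equivariant blow-up of a
finite stable set `Z` of closed points, a point `x` over `z ∈ Z` with `𝒪_{X′,z}` regular of
dimension `3`, residue characteristics `p`, and `κ(z) → κ(x)` NOT surjective (every non-closed
point of the exceptional divisor `E_z ≅ ℙ²_{κ(z)}`, every closed point with a residue extension)
has p-closed inertia. Hence `NPC(X♯) ∩ E_z` is a finite set of `κ(z)`-rational closed points.
[folklore] -/
theorem hasNormalSylow_inertia_of_pointBlowup_regular_three (p : ℕ) [Fact p.Prime]
    {X' X₁ : Scheme.{0}} (q : X' ⟶ X₁) [IsAffineHom q]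
    {G : Type} [Group G] [Finite G] (ρ : G →* Aut X') (hfaith : Function.Injective ρ)
    (hρ : ∀ g : G, (ρ g).hom ≫ q = q) [IsIntegral X'] [IsLocallyNoetherian X']
    {Z : Set X'} (hZc : IsClosed Z) (hZf : Z.Finite) (hZpt : ∀ z ∈ Z, IsClosed ({z} : Set X'))
    {Xs : Scheme.{0}} {π : Xs ⟶ X'}
    (hπ : IsBlowup π (Scheme.IdealSheafData.vanishingIdeal ⟨Z, hZc⟩)) [IsIntegral Xs]
    (ρs : G →* Aut Xs) (hequiv : ∀ g : G, (ρs g).hom ≫ π = π ≫ (ρ g).hom)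
    (x : Xs) (hx : π.base x ∈ Z)
    [CharP (ResidueField (X'.presheaf.stalk (π.base x))) p]
    [CharP (ResidueField (Xs.presheaf.stalk x)) p]
    [IsRegularLocalRing (X'.presheaf.stalk (π.base x))]
    (hdim3 : ringKrullDim (X'.presheaf.stalk (π.base x)) = (3 : ℕ))
    (hκ : ¬ Function.Surjective (ResidueField.map (π.stalkMap x).hom)) :
    HasNormalSylow p (inertiaSubgroup ρs x) := by
  obtain ⟨y, hy⟩ := exists_fin_three_span_eq_maximalIdeal (X'.presheaf.stalk (π.base x)) hdim3
  exact hasNormalSylow_inertia_of_pointBlowup_of_not_surjective p q ρ hfaith hρ hZc hZf hZpt hπ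
    ρs hequiv x hx y hy hκ

end Summit.ResolutionOfSingularities.ResolutionOfSingularities.Theorems.WildQuotientResolution.PointMoveNoNpcCurves
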